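import Summits.Ventures.CertifiedManyBodySolver.Upper.IntervalReaderHubbardAutomaton
import Summits.Ventures.CertifiedManyBodySolver.Upper.IntervalReaderEnclosure

/-!
# Ventures/CertifiedManyBodySolver — Upper/IntervalReaderHubbardKernel.lean: E1's automaton represents `H`
(part 15 of the Theorem-H1′ package; parts 1–14: `IntervalReaderSchur` … `IntervalReaderHubbardAutomaton`)

HONEST FRAMING: first certified bounds; not a superconductivity verdict; every number certified or labelled
float.  Pure algebra (part 13's path sums + the tree's Jordan–Wigner dictionary of part 9); no number is
certified here, no row moves, nothing is said about the Hubbard model's spectrum or the thermodynamic limit.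

Part 7 reduced «E1's multi-state automaton (the integer MPO of `hubbard_mpo.py`) represents `den · H`» to the
finite claim `Matrix.of (fun σ τ => automatonKernel L O σ τ START FINAL) = den • H` and left it open for every
model; parts 8–12 therefore closed the lineage's soundness chain end to end only for the ONE-STATE route (one
sweep per product word).  This file proves the claim for E1's actual automaton (part 14), for every weighted
hopping + on-site model on the enumeration order `Fin N`:

* `hubbard_excursion_dag` / `hubbard_excursion_ann` — the excursion through the channel opened at `k` and closed
  at `k′ > k` IS the hopping word: `−w k k′ · ⨂ hopFamily k k′ σ σ` resp. `−w k k′ · ⨂ hopFamily k′ k σ σ`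
  (`= −w k k′ · toSpin (c†_{kσ} c_{k′σ})` resp. `toSpin (c†_{k′σ} c_{kσ})` by part 9) — weight `0` or a channel
  opened elsewhere gives `0`;
* `automatonKernel_hubbard_start_fin` — **THE IDENTITY**:
  `K(START, FINAL) = Σ_k onSite k (V k) − Σ_{k<k′} Σ_σ w k k′ • (⨂ hopFamily k k′ σ σ + ⨂ hopFamily k′ k σ σ)`;
* `automatonKernel_graphAutomaton_eq_toSpin_hamiltonian` — with `w x y = t · [G.Adj x y]`, `V k = U • n_↑n_↓`
  (`graphAutomaton G t U`) the kernel IS `toSpin (hamiltonian G t U)`, for EVERY finite graph `G` on `Fin N`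
  (part 9's `toSpin_hamiltonian_eq_sum_productOp` + `sum_sum_eq_sum_sum_lt`); the 2-D boxes of the FORMAT-mps1
  rows enter through their enumeration exactly as in parts 9–10;
* `reader_encloses_hamiltonian_element` — part 12's `reader_encloses_matrix_element` with its premise `hW`
  DISCHARGED: given only the per-step defect bounds of the reader's computed environments over E1's automaton,
  the number read out of the last `FINAL` environment is within the printed radius (times the boundary factor,
  `1` for unit vectors) of `star (ψ_l) ⬝ᵥ (toSpin (hamiltonian G t U) *ᵥ ψ_{l′})` of the witness itself.

So the MULTI-STATE route of the lineage (one `H`-sweep through E1's `strans`) is end to end in the tree, as the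
one-state route already was.  What stays outside the tree (unchanged): the contraction arithmetic (kit jobs),
byte-exactness of the integer GEMMs, and the sixteen-entry-per-row reading of E1's integer tables in the tree's
site basis (part 14's docstring).
-/

noncomputable section

open Matrix Finset
open scoped BigOperators ComplexOrder

namespace Summit.Ventures.CertifiedManyBodySolver.Upper.IntervalReader

open Literature.MathematicalPhysics.QuantumLattice
open Literature.MathematicalPhysics.QuantumLattice.JordanWigner

section Hubbard

variable {N : ℕ} (w : Fin N → Fin N → ℂ) (V : Fin N → Matrix (Fin 4) (Fin 4) ℂ)

/-! ## §CC  The excursions are the hopping words -/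

/-- **The `dag` excursion is the hopping word.**  Opened at `k`, closed at `k′ > k`: the excursion's product
operator is `−w k k′ · ⨂ hopFamily k k′ σ σ` (`= −w k k′ · toSpin (c†_{kσ} c_{k′σ})` by part 9). -/
theorem hubbard_excursion_dag {k k' : Fin N} (hkk' : k < k') (σ : Fin 2) (ξ η : TensorIndex (Fin N) 4) :
    productOp (spliceFamily (fun j => hubbardAutomaton w V j HState.start HState.start) k
        (hubbardAutomaton w V k HState.start (HState.dag k σ))
        (spliceFamily (fun j => hubbardAutomaton w V j (HState.dag k σ) (HState.dag k σ)) k'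
          (hubbardAutomaton w V k' (HState.dag k σ) HState.fin)
          (fun j => hubbardAutomaton w V j HState.fin HState.fin))) ξ η =
      -(w k k') * productOp (hopFamily k k' σ σ) ξ η := by
  by_cases hw : w k k' = 0
  · rw [hw, neg_zero, zero_mul]
    refine productOp_apply_eq_zero_of_apply _ (j := k') ?_ ξ η
    have h1 : ¬ k' < k := not_lt.mpr hkk'.le
    have h2 : k' ≠ k := ne_of_gt hkk'
    simp only [spliceFamily, h1, h2, if_false, lt_irrefl, if_true, hubbardAutomaton_dag_fin, hkk', hw, neg_zero,
      zero_smul]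
  · have hlive : ∀ j, j < k' → (∃ y, j < y ∧ w k y ≠ 0) := fun j hj => ⟨k', hj, hw⟩
    have hfam : spliceFamily (fun j => hubbardAutomaton w V j HState.start HState.start) k
        (hubbardAutomaton w V k HState.start (HState.dag k σ))
        (spliceFamily (fun j => hubbardAutomaton w V j (HState.dag k σ) (HState.dag k σ)) k'
          (hubbardAutomaton w V k' (HState.dag k σ) HState.fin)
          (fun j => hubbardAutomaton w V j HState.fin HState.fin)) =
        fun j => (if j = k' then -(w k k') else 1) • hopFamily k k' σ σ j := by
      rw [hopFamily_eq_spliceFamily hkk']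
      funext j
      simp only [spliceFamily, hubbardAutomaton_start_start, hubbardAutomaton_fin_fin, hubbardAutomaton_start_dag,
        hubbardAutomaton_dag_dag, hubbardAutomaton_dag_fin, hkk', if_true]
      rcases lt_trichotomy j k with hjk | rfl | hkj
      · have h2 : j ≠ k' := ne_of_lt (hjk.trans hkk')
        simp [hjk, h2]
      · have h2 : j ≠ k' := ne_of_lt hkk'
        simp [h2, hlive j hkk']
      · rcases lt_trichotomy j k' with hjk' | rfl | hk'j
        · have h1 : j ≠ k := ne_of_gt hkj
          have h2 : j ≠ k' := ne_of_lt hjk'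
          simp [h1, h2, hjk', not_lt.mpr hkj.le, hkj, hlive j hjk']
        · have h1 : j ≠ k := ne_of_gt hkj
          simp [h1, not_lt.mpr hkj.le]
        · have h1 : j ≠ k := ne_of_gt hkj
          have h2 : j ≠ k' := ne_of_gt hk'j
          simp [h1, h2, not_lt.mpr hkj.le, not_lt.mpr hk'j.le]
    rw [hfam, productOp_smul_family_apply, Finset.prod_ite_eq']
    simp

/-- **The `ann` excursion is the reversed hopping word.**  Opened at `k`, closed at `k′ > k`:
`−w k k′ · ⨂ hopFamily k′ k σ σ` (`= −w k k′ · toSpin (c†_{k′σ} c_{kσ})`). -/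
theorem hubbard_excursion_ann {k k' : Fin N} (hkk' : k < k') (σ : Fin 2) (ξ η : TensorIndex (Fin N) 4) :
    productOp (spliceFamily (fun j => hubbardAutomaton w V j HState.start HState.start) k
        (hubbardAutomaton w V k HState.start (HState.ann k σ))
        (spliceFamily (fun j => hubbardAutomaton w V j (HState.ann k σ) (HState.ann k σ)) k'
          (hubbardAutomaton w V k' (HState.ann k σ) HState.fin)
          (fun j => hubbardAutomaton w V j HState.fin HState.fin))) ξ η =
      -(w k k') * productOp (hopFamily k' k σ σ) ξ η := by
  by_cases hw : w k k' = 0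
  · rw [hw, neg_zero, zero_mul]
    refine productOp_apply_eq_zero_of_apply _ (j := k') ?_ ξ η
    have h1 : ¬ k' < k := not_lt.mpr hkk'.le
    have h2 : k' ≠ k := ne_of_gt hkk'
    simp only [spliceFamily, h1, h2, if_false, lt_irrefl, if_true, hubbardAutomaton_ann_fin, hkk', hw, neg_zero,
      zero_smul]
  · have hlive : ∀ j, j < k' → (∃ y, j < y ∧ w k y ≠ 0) := fun j hj => ⟨k', hj, hw⟩
    have hfam : spliceFamily (fun j => hubbardAutomaton w V j HState.start HState.start) k
        (hubbardAutomaton w V k HState.start (HState.ann k σ))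
        (spliceFamily (fun j => hubbardAutomaton w V j (HState.ann k σ) (HState.ann k σ)) k'
          (hubbardAutomaton w V k' (HState.ann k σ) HState.fin)
          (fun j => hubbardAutomaton w V j HState.fin HState.fin)) =
        fun j => (if j = k' then -(w k k') else 1) • hopFamily k' k σ σ j := by
      rw [hopFamily_eq_spliceFamily' hkk']
      funext j
      simp only [spliceFamily, hubbardAutomaton_start_start, hubbardAutomaton_fin_fin, hubbardAutomaton_start_ann,
        hubbardAutomaton_ann_ann, hubbardAutomaton_ann_fin, hkk', if_true]
      rcases lt_trichotomy j k with hjk | rfl | hkj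
      · have h2 : j ≠ k' := ne_of_lt (hjk.trans hkk')
        simp [hjk, h2]
      · have h2 : j ≠ k' := ne_of_lt hkk'
        simp [h2, hlive j hkk']
      · rcases lt_trichotomy j k' with hjk' | rfl | hk'j
        · have h1 : j ≠ k := ne_of_gt hkj
          have h2 : j ≠ k' := ne_of_lt hjk'
          simp [h1, h2, hjk', not_lt.mpr hkj.le, hkj, hlive j hjk']
        · have h1 : j ≠ k := ne_of_gt hkj
          simp [h1, not_lt.mpr hkj.le]
        · have h1 : j ≠ k := ne_of_gt hkj
          have h2 : j ≠ k' := ne_of_gt hk'j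
          simp [h1, h2, not_lt.mpr hkj.le, not_lt.mpr hk'j.le]
    rw [hfam, productOp_smul_family_apply, Finset.prod_ite_eq']
    simp

/-- **THE IDENTITY.**  The `(START, FINAL)` kernel entry of E1's automaton over the `N` sites is the model's
Hamiltonian in the Jordan–Wigner product basis: on-site words plus, for every pair `k < k′` and spin `σ`, the two
hopping words weighted `−w k k′`:
`K(start, fin) = Σ_k onSite k (V k) − Σ_{k<k′} Σ_σ w k k′ • (⨂ hopFamily k k′ σ σ + ⨂ hopFamily k′ k σ σ)`. -/
theorem automatonKernel_hubbard_start_fin (ξ η : TensorIndex (Fin N) 4) :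
    automatonKernel N (hubbardAutomaton w V) ξ η HState.start HState.fin =
      (∑ k, onSite k (V k) -
        ∑ k, ∑ k', ∑ σ : Fin 2, if k < k' then
          w k k' • (productOp (hopFamily k k' σ σ) + productOp (hopFamily k' k σ σ)) else 0) ξ η := by
  rw [automatonKernel_source_apply N (hubbardAutomaton w V) HState.start HState.fin HState.start_ne_fin
    (hubbardAutomaton_fin_of_ne w V) (hubbardAutomaton_channel_of_ne w V) ξ η]
  simp only [Matrix.sub_apply, Matrix.sum_apply]
  rw [sub_eq_add_neg, ← Finset.sum_neg_distrib]
  congr 1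
  · -- direct jumps: the on-site words
    refine Finset.sum_congr rfl fun k _ => ?_
    simp only [hubbardAutomaton_start_start, hubbardAutomaton_start_fin, hubbardAutomaton_fin_fin]
    rw [spliceFamily_const_eq_update, ← onSite_eq_productOp]
  · -- excursions: the hopping words
    refine Finset.sum_congr rfl fun k _ => ?_
    rw [← Finset.sum_neg_distrib]
    refine Finset.sum_congr rfl fun k' _ => ?_
    by_cases hkk' : k < k'
    · simp only [hkk', true_and, if_true]
      rw [Fintype.sum_sum_type, Fintype.sum_bool, Fintype.sum_prod_type, Fintype.sum_bool, Fintype.sum_prod_type,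
        Fintype.sum_prod_type]
      -- the two non-channel states contribute nothing; the channel conditions hold
      simp only [HState.start, HState.fin, ne_eq, Sum.inl.injEq, reduceCtorEq, not_true_eq_false, not_false_eq_true,
        Bool.false_eq_true, Bool.true_eq_false, false_and, and_false, and_self, if_false, if_true, zero_add, add_zero]
      -- each excursion is a hopping word; only the channel opened AT `k` survives
      have hdag : ∀ (x : Fin N) (σ : Fin 2), productOp (spliceFamily
          (fun j => hubbardAutomaton w V j (Sum.inl true) (Sum.inl true)) k
          (hubbardAutomaton w V k (Sum.inl true) (Sum.inr (false, x, σ)))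
          (spliceFamily (fun j => hubbardAutomaton w V j (Sum.inr (false, x, σ)) (Sum.inr (false, x, σ))) k'
            (hubbardAutomaton w V k' (Sum.inr (false, x, σ)) (Sum.inl false))
            (fun j => hubbardAutomaton w V j (Sum.inl false) (Sum.inl false)))) ξ η =
          if x = k then -(w k k') * productOp (hopFamily k k' σ σ) ξ η else 0 := by
        intro x σ
        by_cases hx : x = k
        · rw [if_pos hx, hx]
          exact hubbard_excursion_dag w V hkk' σ ξ η
        · rw [if_neg hx]
          have h0 : hubbardAutomaton w V k (Sum.inl true) (Sum.inr (false, x, σ)) = 0 := by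
            rw [← HState.start, ← HState.dag, hubbardAutomaton_start_dag, if_neg (fun h => hx h.1)]
          rw [h0, productOp_spliceFamily_zero_apply]
      have hann : ∀ (x : Fin N) (σ : Fin 2), productOp (spliceFamily
          (fun j => hubbardAutomaton w V j (Sum.inl true) (Sum.inl true)) k
          (hubbardAutomaton w V k (Sum.inl true) (Sum.inr (true, x, σ)))
          (spliceFamily (fun j => hubbardAutomaton w V j (Sum.inr (true, x, σ)) (Sum.inr (true, x, σ))) k'
            (hubbardAutomaton w V k' (Sum.inr (true, x, σ)) (Sum.inl false))
            (fun j => hubbardAutomaton w V j (Sum.inl false) (Sum.inl false)))) ξ η =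
          if x = k then -(w k k') * productOp (hopFamily k' k σ σ) ξ η else 0 := by
        intro x σ
        by_cases hx : x = k
        · rw [if_pos hx, hx]
          exact hubbard_excursion_ann w V hkk' σ ξ η
        · rw [if_neg hx]
          have h0 : hubbardAutomaton w V k (Sum.inl true) (Sum.inr (true, x, σ)) = 0 := by
            rw [← HState.start, ← HState.ann, hubbardAutomaton_start_ann, if_neg (fun h => hx h.1)]
          rw [h0, productOp_spliceFamily_zero_apply]
      simp only [hdag, hann]
      rw [Finset.sum_comm (f := fun x σ => if x = k then -(w k k') * productOp (hopFamily k' k σ σ) ξ η else 0),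
        Finset.sum_comm (f := fun x σ => if x = k then -(w k k') * productOp (hopFamily k k' σ σ) ξ η else 0)]
      simp only [Finset.sum_ite_eq', Finset.mem_univ, if_true]
      rw [← Finset.sum_add_distrib, ← Finset.sum_neg_distrib]
      refine Finset.sum_congr rfl fun σ _ => ?_
      rw [Matrix.smul_apply, Matrix.add_apply, smul_eq_mul]
      ring
    · simp [hkk']

/-! ## §DD  `hamiltonian G t U` of any finite graph -/

/-- E1's automaton for the plain Hubbard model `hamiltonian G t U` of a finite graph `G` on the enumeration order:
hopping weight `t` on the edges, on-site word `U • n_↑n_↓`. -/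
def graphAutomaton (G : SimpleGraph (Fin N)) [DecidableRel G.Adj] (t U : ℝ) :
    Fin N → HState N → HState N → Matrix (Fin 4) (Fin 4) ℂ :=
  hubbardAutomaton (fun x y => if G.Adj x y then (t : ℂ) else 0) (fun _ => (U : ℂ) • siteDouble)

/-- **E1's automaton represents `H` — for every finite graph.**  On the enumeration order `Fin N` (the reader's =
the Jordan–Wigner order), the `(START, FINAL)` kernel of the automaton with weights `t · [G.Adj x y]` and on-site
words `U • n_↑n_↓` IS `toSpin (hamiltonian G t U)` — the premise `hW` of part 12's `reader_encloses_matrix_element`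
and the claim part 7 left open, now a theorem (plain `t`, `U`; no `den` is needed over `ℂ` — E1's `den` only makes
the table integral). -/
theorem automatonKernel_graphAutomaton_eq_toSpin_hamiltonian (G : SimpleGraph (Fin N)) [DecidableRel G.Adj]
    (t U : ℝ) :
    (Matrix.of fun ξ η : TensorIndex (Fin N) 4 => automatonKernel N (graphAutomaton G t U) ξ η HState.start HState.fin)
      = toSpin (hamiltonian G t U) := by
  -- the two sides as operators
  have hon : ∑ k : Fin N, onSite k ((U : ℂ) • siteDouble) =
      (U : ℂ) • ∑ x : Fin N, productOp (Function.update (fun _ => (1 : Matrix (Fin 4) (Fin 4) ℂ)) x siteDouble) := by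
    rw [Finset.smul_sum]
    exact Finset.sum_congr rfl fun k _ => by rw [onSite_smul', onSite_eq_productOp]
  have hhop : (∑ k : Fin N, ∑ k' : Fin N, ∑ σ : Fin 2, if k < k' then
        (if G.Adj k k' then (t : ℂ) else 0) • (productOp (hopFamily k k' σ σ) + productOp (hopFamily k' k σ σ))
        else 0) =
      (t : ℂ) • ∑ x : Fin N, ∑ y : Fin N, ∑ σ : Fin 2,
        if G.Adj x y then productOp (hopFamily x y σ σ) else (0 : Op (Fin N) 4) := by
    rw [sum_sum_eq_sum_sum_lt (fun x y => ∑ σ : Fin 2,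
      if G.Adj x y then productOp (hopFamily x y σ σ) else (0 : Op (Fin N) 4)) (fun x => by simp), Finset.smul_sum]
    refine Finset.sum_congr rfl fun x _ => ?_
    rw [Finset.smul_sum]
    refine Finset.sum_congr rfl fun y _ => ?_
    by_cases hxy : x < y
    · by_cases hadj : G.Adj x y
      · have hadj' : G.Adj y x := hadj.symm
        simp only [hxy, hadj, hadj', if_true, Finset.smul_sum, ← Finset.sum_add_distrib, smul_add]
      · have hadj' : ¬ G.Adj y x := fun h => hadj h.symm
        simp [hadj, hadj']
    · simp [hxy]
  ext ξ η
  rw [Matrix.of_apply, graphAutomaton, automatonKernel_hubbard_start_fin, toSpin_hamiltonian_eq_sum_productOp,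
    hon, hhop, neg_smul, sub_eq_neg_add]

end Hubbard

/-! ## §EE  End to end: the multi-state reader encloses `⟨ψ_l, H ψ_{l′}⟩` -/

section EndToEnd

open WithLp
open scoped Matrix.Norms.L2Operator

variable {N D : ℕ}

/-- **Theorem H1′ end to end for the `H`-sweep of E1's multi-state reader.**  For a finite graph `G` on the
enumeration order, couplings `t, U`, the witness tensors `A`, and the reader's COMPUTED environment families `Ŷ`
over E1's automaton `graphAutomaton G t U` (states `HState N`; dead channels carry `0`, `automatonStep_dead`) with
per-step defect bounds `ρ`, Gram constants `κ`, operator constants `M` and a radius recursion `rad` exactly as in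
part 12: the number the reader pairs out of its last `FINAL` environment is within `(Σ‖r i‖)(Σ‖r′ j‖) · rad N FINAL`
of `star (ψ_l) ⬝ᵥ (toSpin (hamiltonian G t U) *ᵥ ψ_{l′})`, `ψ_v = mpsOpenVar N A v r(′)`.  No hypothesis about what
the automaton represents remains: that is `automatonKernel_graphAutomaton_eq_toSpin_hamiltonian`. -/
theorem reader_encloses_hamiltonian_element (G : SimpleGraph (Fin N)) [DecidableRel G.Adj] (t U : ℝ)
    (A : Fin N → MPSTensor 4 D)
    (κ : Fin N → ℝ) (hκ0 : ∀ k, 0 ≤ κ k)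
    (hκ : ∀ k (z : EuclideanSpace ℂ (Fin D)), ∑ s, ‖toLp 2 (A k s *ᵥ ofLp z)‖ ^ 2 ≤ κ k * ‖z‖ ^ 2)
    (M : Fin N → HState N → HState N → ℝ) (hM0 : ∀ k b c, 0 ≤ M k b c)
    (hMrow : ∀ k b c s, ∑ s', ‖graphAutomaton G t U k b c s s'‖ ≤ M k b c)
    (hMcol : ∀ k b c s', ∑ s, ‖graphAutomaton G t U k b c s s'‖ ≤ M k b c)
    (l l' r r' : Fin D → ℂ) (Yh : Fin (N + 1) → HState N → Matrix (Fin D) (Fin D) ℂ) (ρ : Fin N → HState N → ℝ)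
    (hρ : ∀ (k : Fin N) (c : HState N),
      ‖Yh k.succ c - ∑ b, transferOp (A k) (graphAutomaton G t U k b c) (Yh k.castSucc b)‖ ≤ ρ k c)
    (rad : Fin (N + 1) → HState N → ℝ)
    (hr0 : ∀ b, ‖Yh 0 b -
      (Pi.single HState.start (vecMulVec (star l) l') : HState N → Matrix (Fin D) (Fin D) ℂ) b‖ ≤ rad 0 b)
    (hr : ∀ (k : Fin N) (c : HState N), ∑ b, M k b c * κ k * rad k.castSucc b + ρ k c ≤ rad k.succ c) :
    ‖star r ⬝ᵥ (Yh (Fin.last N) HState.fin *ᵥ r') -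
        star (mpsOpenVar N A l r) ⬝ᵥ (toSpin (hamiltonian G t U) *ᵥ mpsOpenVar N A l' r')‖ ≤
      (∑ i, ‖r i‖) * (∑ j, ‖r' j‖) * rad (Fin.last N) HState.fin :=
  reader_encloses_matrix_element N A (graphAutomaton G t U) κ hκ0 hκ M hM0 hMrow hMcol HState.start HState.fin
    (toSpin (hamiltonian G t U))
    (fun σ τ => by rw [← automatonKernel_graphAutomaton_eq_toSpin_hamiltonian G t U, Matrix.of_apply])
    l l' r r' Yh ρ hρ rad hr0 hr

end EndToEnd


end Summit.Ventures.CertifiedManyBodySolver.Upper.IntervalReader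

end
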